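import Mathlib
import Literature.Computability.AlgebraicComplexity.LinSubst

/-!
# Border apolarity, crux `ToricWitnessObstructionQP` (stmt-ValiantsHypothesis-14753),
# line `Sketch`, reshape 4: helper stubs `snf_transvection_expansion` and
# `snf_X_mul_pderiv_mem` (polarisation)

Route `ValiantsHypothesis/BorderApolarity`, crux item `stmt-ValiantsHypothesis-14753`,
line `Sketch`, reshape 4 (structure of stable normal forms), wave-3 helpers
`snf_transvection_expansion` and `snf_X_mul_pderiv_mem`.

The residual of the line records that certain operator spaces are stable under the
substitutions `linSubst (1 + C)` with `C` supported on unused rows × own columns.  The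
one-parameter case is the transvection `T_c := linSubst (1 + c • Matrix.single z u 1)`, which
maps `X u ↦ X u + c • X z` and fixes every other variable.  The two theorems of this file
extract its infinitesimal generator:

* `snf_transvection_expansion`: `T_c f = ∑_{j ≤ R} c ^ j • F j` for all `c`, with `F 0 = f` and
  `F 1 = X z * ∂_u f`.  We realise `T_c f` as the evaluation at `C c` of the one-variable
  polynomial `P_f := aeval (X i ↦ C (X i) + [i = u] • t • C (X z)) f ∈ (MvPolynomial σ ℂ)[t]`
  and take `F j := coeff P_f j`; the coefficient of `t` is computed by induction on `f`.
* `snf_X_mul_pderiv_mem`: a `ℂ`-subspace stable under all `T_c` is stable under the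
  polarisation `f ↦ X z * ∂_u f`, by Vandermonde extraction of the coefficients `F j` from the
  values of `c ↦ ∑ c ^ j • F j` at the `R + 1` distinct points `0, 1, …, R`.
-/

open MvPolynomial Filter
open scoped BigOperators Matrix
open Literature.Computability.AlgebraicComplexity

set_option linter.dupNamespace false

namespace Summit.ValiantsHypothesis.ValiantsHypothesis.Theorems.BorderApolarityToricWitnessObstructionQP

section Transvection

variable {σ : Type} [Fintype σ] [DecidableEq σ]

/-- The transvection `1 + c • E_{z u}` acts on variables by
`X i ↦ X i + [i = u] • c • X z`. [folklore] -/
theorem snfpol_transvection_X (u z : σ) (c : ℂ) (i : σ) :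
    linSubst σ ℂ (1 + c • Matrix.single z u (1 : ℂ)) (X i) =
      X i + if i = u then c • X z else 0 := by
  rw [linSubst_X]
  simp only [Matrix.add_apply, Matrix.one_apply, Matrix.smul_apply, Matrix.single_apply,
    smul_eq_mul, mul_ite, mul_one, mul_zero, add_smul, Finset.sum_add_distrib, ite_smul,
    one_smul, zero_smul, Finset.sum_ite_eq', Finset.mem_univ, if_true, ite_and,
    Finset.sum_ite_eq]
  congr 1
  by_cases h : i = u
  · simp [h]
  · simp [h, Ne.symm h]

/-- The generating polynomial `P_f(t) := f(X_u + t X_z)` evaluates at `t = c` to the transvection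
`T_c f`. [folklore] -/
theorem snfpol_eval_genPoly (u z : σ) (c : ℂ) (f : MvPolynomial σ ℂ) :
    (aeval (fun i : σ => Polynomial.C (X i : MvPolynomial σ ℂ) +
        if i = u then Polynomial.X * Polynomial.C (X z : MvPolynomial σ ℂ) else 0) f).eval
        (C c) = linSubst σ ℂ (1 + c • Matrix.single z u (1 : ℂ)) f := by
  induction f using MvPolynomial.induction_on with
  | C a =>
    rw [linSubst_C, aeval_C, Polynomial.algebraMap_apply, Polynomial.eval_C, algebraMap_eq]
  | add p q hp hq => rw [map_add, Polynomial.eval_add, hp, hq, map_add]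
  | mul_X p i hp =>
    rw [map_mul, Polynomial.eval_mul, hp, map_mul, aeval_X, snfpol_transvection_X]
    split_ifs
    · rw [Polynomial.eval_add, Polynomial.eval_C, Polynomial.eval_mul, Polynomial.eval_X,
        Polynomial.eval_C, smul_eq_C_mul]
    · rw [add_zero, add_zero, Polynomial.eval_C]

/-- The constant coefficient of the generating polynomial `P_f` is `f`. [folklore] -/
theorem snfpol_coeff_zero_genPoly (u z : σ) (f : MvPolynomial σ ℂ) :
    (aeval (fun i : σ => Polynomial.C (X i : MvPolynomial σ ℂ) +
        if i = u then Polynomial.X * Polynomial.C (X z : MvPolynomial σ ℂ) else 0) f).coeff 0 =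
      f := by
  rw [Polynomial.coeff_zero_eq_eval_zero, ← C_0, snfpol_eval_genPoly, zero_smul, add_zero,
    linSubst_one, AlgHom.id_apply]

/-- The coefficient of `t` in the generating polynomial `P_f` is the polarisation `X z * ∂_u f`.
[folklore] -/
theorem snfpol_coeff_one_genPoly (u z : σ) (f : MvPolynomial σ ℂ) :
    (aeval (fun i : σ => Polynomial.C (X i : MvPolynomial σ ℂ) +
        if i = u then Polynomial.X * Polynomial.C (X z : MvPolynomial σ ℂ) else 0) f).coeff 1 =
      X z * pderiv u f := by
  induction f using MvPolynomial.induction_on with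
  | C a =>
    rw [aeval_C, Polynomial.algebraMap_apply, Polynomial.coeff_C, if_neg one_ne_zero, pderiv_C,
      mul_zero]
  | add p q hp hq => rw [map_add, Polynomial.coeff_add, hp, hq, map_add, mul_add]
  | mul_X p i hp =>
    have h0 := snfpol_coeff_zero_genPoly u z p
    rw [map_mul, aeval_X, pderiv_mul]
    split_ifs with hi
    · subst hi
      rw [mul_add, Polynomial.coeff_add, Polynomial.coeff_mul_C, hp, ← mul_assoc,
        Polynomial.coeff_mul_C, Polynomial.coeff_mul_X, h0, pderiv_X_self]
      ring
    · rw [add_zero, Polynomial.coeff_mul_C, hp, pderiv_X_of_ne hi]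
      ring

/-- **Transvection expansion** (exported form): for every `f` there are `R` and coefficients
`F 0 = f`, `F 1 = X z * ∂_u f`, `F j = 0` for `j > R`, with
`T_c f = ∑_{j ≤ R} c ^ j • F j` for all `c`. [folklore] -/
theorem snf_transvection_expansion : ∀ {σ : Type} [Fintype σ] [DecidableEq σ] (u z : σ)
    (f : MvPolynomial σ ℂ), ∃ (R : ℕ) (F : ℕ → MvPolynomial σ ℂ), F 0 = f ∧ F 1 = X z * pderiv u f ∧
      (∀ j, R < j → F j = 0) ∧
      ∀ c : ℂ, linSubst σ ℂ (1 + c • Matrix.single z u (1 : ℂ)) f = ∑ j ∈ Finset.range (R + 1), c ^ j • F j := by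
  intro σ _ _ u z f
  set P : Polynomial (MvPolynomial σ ℂ) :=
    aeval (fun i : σ => Polynomial.C (X i : MvPolynomial σ ℂ) +
      if i = u then Polynomial.X * Polynomial.C (X z : MvPolynomial σ ℂ) else 0) f
  refine ⟨P.natDegree, fun j => P.coeff j, snfpol_coeff_zero_genPoly u z f,
    snfpol_coeff_one_genPoly u z f, fun j hj => Polynomial.coeff_eq_zero_of_natDegree_lt hj, ?_⟩
  intro c
  rw [← snfpol_eval_genPoly u z c f, Polynomial.eval_eq_sum_range]
  refine Finset.sum_congr rfl fun j _ => ?_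
  rw [← C_pow, mul_comm, C_mul']

end Transvection

section Vandermonde

variable {V : Type*} [AddCommGroup V] [Module ℂ V]

/-- **Vandermonde extraction**: if the values of `c ↦ ∑_{j ≤ R} c ^ j • F j` lie in a
subspace `J` for all scalars `c`, then so does every coefficient `F j`, `j ≤ R`. [folklore] -/
theorem snfpol_vandermonde_mem (J : Submodule ℂ V) (R : ℕ) (F : ℕ → V)
    (h : ∀ c : ℂ, (∑ j ∈ Finset.range (R + 1), c ^ j • F j) ∈ J) :
    ∀ j ∈ Finset.range (R + 1), F j ∈ J := by
  intro j hj
  -- nodes `0, 1, …, R` and the Vandermonde matrix `M i l = i ^ l`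
  set v : Fin (R + 1) → ℂ := fun i => ((i : ℕ) : ℂ)
  set M : Matrix (Fin (R + 1)) (Fin (R + 1)) ℂ := Matrix.vandermonde v with hM
  have hdet : IsUnit M.det := by
    rw [isUnit_iff_ne_zero, hM, Matrix.det_vandermonde_ne_zero_iff]
    intro a b hab
    exact Fin.ext (Nat.cast_injective (R := ℂ) hab)
  have hval : ∀ i : Fin (R + 1), (∑ l : Fin (R + 1), M i l • F l) ∈ J := by
    intro i
    have := h (v i)
    rw [Finset.sum_range (fun l => v i ^ l • F l)] at this
    simpa [hM, Matrix.vandermonde_apply] using this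
  -- invert: `F j = ∑ i, M⁻¹ j i • (∑ l, M i l • F l)`, a combination of members of `J`
  have hcalc : (∑ i : Fin (R + 1), M⁻¹ ⟨j, Finset.mem_range.mp hj⟩ i •
      ∑ l : Fin (R + 1), M i l • F l) = F j := by
    simp_rw [Finset.smul_sum, smul_smul]
    rw [Finset.sum_comm]
    simp_rw [← Finset.sum_smul, ← Matrix.mul_apply, Matrix.nonsing_inv_mul _ hdet,
      Matrix.one_apply, ite_smul, one_smul, zero_smul, Finset.sum_ite_eq, Finset.mem_univ,
      if_true]
  rw [← hcalc]
  exact Submodule.sum_mem _ fun i _ => Submodule.smul_mem _ _ (hval i)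

end Vandermonde

/-- **Polarisation preserves transvection-stable subspaces**: a `ℂ`-subspace of polynomials
stable under all transvections `X u ↦ X u + c • X z` is stable under `f ↦ X z * ∂_u f`.
[folklore] -/
theorem snf_X_mul_pderiv_mem : ∀ {σ : Type} [Fintype σ] [DecidableEq σ]
    (J : Submodule ℂ (MvPolynomial σ ℂ)) (u z : σ),
    (∀ c : ℂ, ∀ f ∈ J, linSubst σ ℂ (1 + c • Matrix.single z u (1 : ℂ)) f ∈ J) →
    ∀ f ∈ J, X z * pderiv u f ∈ J := by
  intro σ _ _ J u z hJ f hf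
  obtain ⟨R, F, -, hF1, hFR, hT⟩ := snf_transvection_expansion u z f
  have hsum : ∀ c : ℂ, (∑ j ∈ Finset.range (R + 1), c ^ j • F j) ∈ J := fun c =>
    hT c ▸ hJ c f hf
  rw [← hF1]
  by_cases hR : 1 < R + 1
  · exact snfpol_vandermonde_mem J R F hsum 1 (Finset.mem_range.mpr hR)
  · rw [hFR 1 (by omega)]
    exact Submodule.zero_mem J

end Summit.ValiantsHypothesis.ValiantsHypothesis.Theorems.BorderApolarityToricWitnessObstructionQP
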